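import Summits.QuantumFields.BalabanUV.Beta.GAN24.LayerLetterMixed
import Summits.QuantumFields.BalabanUV.Beta.GAN24.LayerLetterGaugeRead

/-!
# `BalabanUV.Beta.GAN24.LayerLetterPsi` — binder row G-an2-4 ∕ (CONV-C), W-slot CT-W, route «WC-TL» ∕ (Q-R) «QR-LL», row (LAY), programme
# «(LAY-LIT) THE LITERAL's LETTER PROFILE ROWS `hS ∧ hω` OF THE (Q-R) END», PART 5:
# **`Ψ_T` — THE SUPER-BLOCK LABEL SUM OF THE EXPLICIT FIRST-ORDER DATA IS A FACE LETTER AT THE SLOT**: for `Ψ` of the DISPLAYED shape of p2 PART 5's `hΨ`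
# (`WardResidualSUnrolled.exists_kernelLaws_unrolled`) with generic letters, `Σ_{y∈T} Ψ y ν y′` is `BiLoc` at `N•y′` with constant `K·W` for every `W ≥ FW_U^{δ∕4}(N•y′)`
# (G-an2-4 formalisation swarm → CRUX TEAM (2), leaf prover `b2b-balaban-gan24-formalise-leaf-03`, gen 61; INTENT 5, journal `CLAIMS.log`; names PROVISIONAL)

NOT IN PRINT; OUR BOOKKEEPING ([folklore] PARTs 2–4 added up: `LayerLetterRotated.biLoc_sum_rotatedVertex_of_faceBound` (α), `LayerLetterMixed.biLoc_sum_vertexOfM_remainder_of_faceW`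
(β), `LayerLetterGaugeRead.biLoc_sum_gaugeSup_faceW_of_faceW` (γ) with `A := G ∘ dM G N S M ν y′` (`SecondOrderResponse.vertexFamily_dM` ⨾ `ExpKernelCalculus.biLoc_comp_decays`);
generic `d`, GENERIC `G ∕ S ∕ M ∕ M2 ∕ RM ∕ c ∕ cH ∕ ρ` — no object of an2's typed system; 0 `def`, 0 cited facts, 0 `def … : Prop`, 0 sorry).  HONEST FRAMING (cell contract,
verbatim): «discharging `BetaPertH` makes Bałaban's UV stability UNCONDITIONAL — a real constructive-QFT result; it is NOT the continuum limit and NOT the Clay problem.»  HONEST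
DEPENDENCY (verbatim): «continuum YM on T⁴ ⇐ BetaPertH ∧ nine spine estimates (0/9 proved); BetaPertH ⇐ (D1) ∧ (D4) ∧ CAP+tail; G-an2-4 gates asym, D1 and NE2/3/4.»

## What
`hΨ` (PART 5 of (REP), generic letters): `Ψ y ν y′ = vertexOfM G N (RM y) ν y′ + ½ • (dM (conjV G X_y) N S M ν y′ − c • 𝒢[G ∘ dM G N S M ν y′](gaugeWt N y))`,
`X_y = diagK (½ • Σ_{v∈box} legInd ρ (N•y + toSite v))`, `𝒢[A](g)` an1's response superposition; `RM` by the displayed mixed table law `hlaw` (cH • flux = [M, X_y] + RM y).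
Classes at ONE rate `0 < δ`: `Decays G CG δ`, `LocStencil S Cs δ`, `VertexFamily M N Cm δ`, `LocStencilFM N M2 C2 δ`; `1 ≤ N`.
* §1 `biLoc_comp_dM` — `A := G ∘ dM G N S M ν y′` is `BiLoc` at `(N•y′, N•y′)`, rate `δ∕4`, constant `CA := |Fib|·CG·CdM·Zl(δ∕4)`,
  `CdM = (d+1)(CG·Cs·Zl(δ∕2)) + (d+1)(CG·Cm·Zl(δ∕2))`; `biLoc_smul_abs`; `sum_psi_eq` (the label sum split into its three pieces, as functions).
* §2 **`biLoc_sum_psi_of_faceW`** — for every finset `T` of labels (fine union `U`), slot `(ν, y′)` and `W ≥ FW_U^{δ∕4}(N•y′)`: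
  `BiLoc (Σ_{y∈T} Ψ y ν y′) (N•y′) (N•y′) ((Kα + Kβ + ½|c|·Kγ)·W) (δ∕8)` with the three PART constants DISPLAYED in the statement (`Kα = ¼(d+1)·CG·e^{δ‖ρ‖₁}·(Cs+Cm)·Zl(δ∕4)`,
  `Kβ = (d+1)·CG·(|cH|·C2 + ½·Cm·e^{δ‖ρ‖₁})·Zl(δ∕6)`, `Kγ = (d+1)·CA·(Cs+Cm)·Zl(δ∕8)`); the one hypothesis `FW^{δ∕4} ≤ W` feeds (α) per site at rate `δ∕2`, (β) as `FW^{δ∕3} ≤ W`,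
  (γ) as `FW^{δ∕4} ≤ W` (`faceW_mono_rate`, `exp_le_faceW_of_mem`); face-sum form **`biLoc_sum_psi`** (`W := FW_U^{δ∕4}(N•y′)`).
READING: the super-block label sum of the letter's first-order data is supported near the boundary layer of the fine union, at the slot anchor, UNIFORMLY IN `T` except through the
face weight — the «shell» of the OWNER's exponent ledger for the literal letter, in kernel form, modulo the DISPLAYED classes.  PART 6 (`LayerLetterEnd`) threads box nesting,
the `G`-sandwich, `mmRead`, the scalar, `unitS` and «fine faces → the END's coarse face sums» to the END's `hS ∧ hω` VERBATIM.  DISCHARGES NO ROW: the literal objects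
(`coDressKBmAt ρ Lc (KInvStep Lc j)`, `SpureRecAt`, `M1At`, `M2Of … mixFF`, `RM_j`, `(stepScale·Lc^{d+1})⁻¹`) and LEVEL-FREE classes for them enter only in PART 6 as displays;
(LAY)'s literal rows, (LT), K-LL-4, the (S) row, the END and (Q-R) are NOT here; 0 estimate of Bałaban's; NOTHING of (Q-R) ∕ (LT) ∕ (Q-L) ∕ (C) ∕ (S) ∕ «T2Shape» ∕ «T2Drift» ∕
(hW, hWall) discharged; NEVER «G-an2-4 closed» as (CONV-C); NOT D1, NOT `BetaPertH`, NOT continuum, NOT Clay.  2026-08-22.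
-/

noncomputable section

namespace Summit.QuantumFields.BalabanUV.Beta.GAN24.LayerLetterPsi

open Finset
open scoped BigOperators
open Literature.MathematicalPhysics.QuantumFieldTheory
open Literature.MathematicalPhysics.QuantumFieldTheory.Balaban1983to89
open Literature.MathematicalPhysics.QuantumFieldTheory.Balaban1983to89.Beta
open Literature.MathematicalPhysics.QuantumFieldTheory.Balaban1983to89.B12Sec2to5 (l1 l1_nonneg)
open B6BondElimination (unitVec)
open ExpKernelCalculus (MKer Site BiLoc Decays VertexFamily comp Zl Zl_nonneg biLoc_comp_decays)
open OneStepResolventKernel (Fib LocStencil wsum)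
open SecondOrderResponse (colM vertexOfM dM LocStencilFM vertexFamily_dM)
open InterLevelTransport (cwsum)
open KernelWard (divV bdd_of_biLoc biLoc_add)
open StepJetData (biLoc_weaken decays_weaken)
open BalabanStepJets (locStencil_mono)
open BalabanStepW2 (vertexFamily_mono')
open AffineAveraging (box toSite)
open Summit.QuantumFields.BalabanUV.Beta.ChartConjugation (conjV)
open Summit.QuantumFields.BalabanUV.Beta.BorderedHessian (diagK)
open Summit.QuantumFields.BalabanUV.Beta.AveragingWardRootedStencils (legInd)
open Summit.QuantumFields.BalabanUV.Beta.KernelWardRelative (gaugeWt)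
open Summit.QuantumFields.BalabanUV.Beta.GAN24.LayerLetterFaces (faceW_nonneg exp_le_faceW_of_mem faceW_mono_rate)
open Summit.QuantumFields.BalabanUV.Beta.GAN24.LayerLetterRotated (biLoc_sum_rotatedVertex_of_faceBound)
open Summit.QuantumFields.BalabanUV.Beta.GAN24.LayerLetterMixed (biLoc_sum_vertexOfM_remainder_of_faceW nonneg_of_locStencilFM)
open Summit.QuantumFields.BalabanUV.Beta.GAN24.LayerLetterGaugeRead (biLoc_sum_gaugeSup_faceW_of_faceW)

variable {d N : ℕ}

/-! ## §1 The response kernel `A = G ∘ dM G N S M ν y′`; scalar multiples; the split of the label sum -/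

/-- [folklore] **THE RESPONSE KERNEL IS BI-LOCALISED AT THE SLOT.**  For `Decays G CG δ`, `LocStencil S Cs δ`, `VertexFamily M N Cm δ` (`0 < δ`):
`BiLoc (G ∘ dM G N S M ν y′) (N•y′) (N•y′) (|Fib|·CG·CdM·Zl(δ∕4)) (δ∕4)`, `CdM = (d+1)(CG·Cs·Zl(δ∕2)) + (d+1)(CG·Cm·Zl(δ∕2))` (`vertexFamily_dM` at rate `δ∕2`, `G` weakened to
rate `δ∕2`, `biLoc_comp_decays` to rate `δ∕4`). -/
theorem biLoc_comp_dM [NeZero N] {G : MKer (d + 1) (Fib d)} {CG δ : ℝ} (hG : Decays G CG δ) (hδ : 0 < δ)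
    {S : Fin (d + 1) → Site (d + 1) → MKer (d + 1) (Fib d)} {Cs : ℝ} (hS : LocStencil S Cs δ)
    {M : Fin (d + 1) → Site (d + 1) → MKer (d + 1) (Fib d)} {Cm : ℝ} (hM : VertexFamily M N Cm δ) (ν : Fin (d + 1)) (y' : Site (d + 1)) :
    BiLoc (comp G (dM G N S M ν y')) ((N : ℤ) • y') ((N : ℤ) • y')
      ((Fintype.card (Fib d) : ℝ) * (CG * (((d + 1 : ℕ) : ℝ) * (CG * Cs * Zl (d + 1) (δ / 2)) + ((d + 1 : ℕ) : ℝ) * (CG * Cm * Zl (d + 1) (δ / 2))))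
        * Zl (d + 1) (δ / 2 - δ / 4)) (δ / 4) := by
  have hCG : 0 ≤ CG := hG.nonneg (Sum.inl 0)
  have hdM := vertexFamily_dM (N := N) hG hCG hS hM hδ le_rfl ν y'
  have hG2 : Decays G CG (δ / 2) := decays_weaken hG le_rfl (by linarith)
  exact biLoc_comp_decays hG2 hdM (by linarith) (by linarith)

/-- [folklore] A scalar multiple of a bi-localised kernel (`|c|`). -/
theorem biLoc_smul_abs {K : MKer (d + 1) (Fib d)} {p q : Site (d + 1)} {C δ : ℝ} (h : BiLoc K p q C δ) (c : ℝ) :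
    BiLoc (c • K) p q (|c| * C) δ := by
  intro x z a b
  rw [Pi.smul_apply, Pi.smul_apply, Pi.smul_apply, Pi.smul_apply, smul_eq_mul, abs_mul, mul_assoc]
  exact mul_le_mul_of_nonneg_left (h x z a b) (abs_nonneg _)

/-- [folklore] THE LABEL SUM SPLIT INTO ITS THREE PIECES (pure algebra on `hΨ`'s shape at a fixed slot): `Σ_{y∈T} Ψ y = Σ_y (β)_y + Σ_y ½•(α)_y + (−½c) • Σ_y (γ)_y`. -/
theorem sum_psi_eq {Ψ Vb Va Vg : Site (d + 1) → MKer (d + 1) (Fib d)} {c : ℝ} (T : Finset (Site (d + 1)))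
    (hΨ : ∀ y ∈ T, Ψ y = Vb y + (1 / 2 : ℝ) • (Va y - c • Vg y)) :
    ∑ y ∈ T, Ψ y = ∑ y ∈ T, Vb y + ∑ y ∈ T, (1 / 2 : ℝ) • Va y + (-((1 / 2 : ℝ) * c)) • ∑ y ∈ T, Vg y := by
  have e : ∀ y ∈ T, Ψ y = Vb y + (1 / 2 : ℝ) • Va y + (-((1 / 2 : ℝ) * c)) • Vg y := by
    intro y hy
    rw [hΨ y hy]
    funext x z a b
    simp only [Pi.add_apply, Pi.sub_apply, Pi.smul_apply, smul_eq_mul]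
    ring
  rw [Finset.sum_congr rfl e, Finset.sum_add_distrib, Finset.sum_add_distrib, Finset.smul_sum]

/-! ## §2 `Ψ_T` is a face letter at the slot -/

/-- [folklore] **`Ψ_T` IS A FACE LETTER AT THE SLOT (face-sum domination form).**  Let `Ψ` have the DISPLAYED shape of p2 PART 5's `hΨ`
(`WardResidualSUnrolled.exists_kernelLaws_unrolled`) with generic letters — `Ψ y ν y′ = vertexOfM G N (RM y) ν y′ + ½ • (dM (conjV G X_y) N S M ν y′ − c • 𝒢_y)`,
`𝒢_y` an1's response superposition of `A = G ∘ dM G N S M ν y′` against `gaugeWt N y`, `X_y = diagK (½ • Σ_{v∈box} legInd ρ (N•y + toSite v))` — and let `RM` satisfy the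
displayed mixed table law `hlaw`.  Classes at one rate `0 < δ`: `Decays G CG δ`, `LocStencil S Cs δ`, `VertexFamily M N Cm δ`, `LocStencilFM N M2 C2 δ`; `1 ≤ N`.  Then for every
finset `T` of labels with fine union `U = T.biUnion (y ↦ (box).image (v ↦ N•y + toSite v))`, every slot `(ν, y′)` and every `W ≥ FW_U^{δ∕4}(N•y′)`:
`BiLoc (Σ_{y∈T} Ψ y ν y′) (N•y′) (N•y′) ((Kα + Kβ + ½|c|·Kγ)·W) (δ∕8)`, the three constants displayed below (PARTs 2, 3, 4; all `T`-, `y′`-, `W`-free).  The one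
hypothesis feeds (α) per layer site at rate `δ∕2`, (β) as `FW^{δ∕3} ≤ W`, (γ) as `FW^{δ∕4} ≤ W` (`exp_le_faceW_of_mem`, `faceW_mono_rate`). -/
theorem biLoc_sum_psi_of_faceW [NeZero N] {G : MKer (d + 1) (Fib d)} {CG δ : ℝ} (hG : Decays G CG δ) (hδ : 0 < δ) (hN : 1 ≤ N)
    {S : Fin (d + 1) → Site (d + 1) → MKer (d + 1) (Fib d)} {Cs : ℝ} (hS : LocStencil S Cs δ)
    {M : Fin (d + 1) → Site (d + 1) → MKer (d + 1) (Fib d)} {Cm : ℝ} (hM : VertexFamily M N Cm δ)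
    {M2 : Fin (d + 1) → Site (d + 1) → Fin (d + 1) → Site (d + 1) → MKer (d + 1) (Fib d)} {C2 : ℝ} (hM2 : LocStencilFM N M2 C2 δ)
    {RM : Site (d + 1) → Fin (d + 1) → Site (d + 1) → MKer (d + 1) (Fib d)} {cH c : ℝ} {ρ : Site (d + 1)}
    (hlaw : ∀ (y : Site (d + 1)) (ρ' : Fin (d + 1)) (w : Site (d + 1)),
      cH • ∑ v ∈ box (d + 1) N, divV (fun κ u => M2 κ u ρ' w) ((N : ℤ) • y + toSite v) =
        comp (M ρ' w) (diagK (((1 : ℝ) / 2) • ∑ v ∈ box (d + 1) N, legInd ρ ((N : ℤ) • y + toSite v)))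
          - comp (diagK (((1 : ℝ) / 2) • ∑ v ∈ box (d + 1) N, legInd ρ ((N : ℤ) • y + toSite v))) (M ρ' w) + RM y ρ' w)
    {Ψ : Site (d + 1) → Fin (d + 1) → Site (d + 1) → MKer (d + 1) (Fib d)}
    (hΨ : ∀ (y : Site (d + 1)) (ν : Fin (d + 1)) (y' : Site (d + 1)), Ψ y ν y' =
      vertexOfM G N (RM y) ν y'
      + (1 / 2 : ℝ) • (dM (conjV G (diagK (((1 : ℝ) / 2) • ∑ v ∈ box (d + 1) N, legInd ρ ((N : ℤ) • y + toSite v)))) N S M ν y'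
        - c • (∑ κ, wsum (fun u => ∑' x₂, ∑ κ₂,
              comp G (dM G N S M ν y') u x₂ (Sum.inl κ) (Sum.inl κ₂) * gaugeWt N y κ₂ x₂) (S κ)
            + ∑ ρ', cwsum N (fun w => ∑' x₂, ∑ κ₂,
              comp G (dM G N S M ν y') ((N : ℤ) • w) x₂ (Sum.inr ρ') (Sum.inl κ₂) * gaugeWt N y κ₂ x₂) (M ρ'))))
    (T : Finset (Site (d + 1))) (ν : Fin (d + 1)) (y' : Site (d + 1)) {W : ℝ}
    (hW : (∑ μ : Fin (d + 1),
          (∑ w' ∈ (T.biUnion (fun y => (box (d + 1) N).image (fun v => (N : ℤ) • y + toSite v))).image (fun v => v - unitVec μ)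
                \ T.biUnion (fun y => (box (d + 1) N).image (fun v => (N : ℤ) • y + toSite v)), Real.exp (-(δ / 4) * l1 (w' - (N : ℤ) • y'))
            + ∑ w' ∈ T.biUnion (fun y => (box (d + 1) N).image (fun v => (N : ℤ) • y + toSite v))
                \ (T.biUnion (fun y => (box (d + 1) N).image (fun v => (N : ℤ) • y + toSite v))).image (fun v => v - unitVec μ),
                  Real.exp (-(δ / 4) * l1 (w' - (N : ℤ) • y')))) ≤ W) :
    BiLoc (∑ y ∈ T, Ψ y ν y') ((N : ℤ) • y') ((N : ℤ) • y')
      (((1 / 4 : ℝ) * (((d : ℝ) + 1) * CG * Real.exp (δ * l1 ρ) * (Cs + Cm) * Zl (d + 1) (δ / 4))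
        + ((d : ℝ) + 1) * CG * (|cH| * C2 + (1 / 2 : ℝ) * Cm * Real.exp (δ * l1 ρ)) * Zl (d + 1) (δ / 6)
        + (1 / 2 : ℝ) * |c| * (((d : ℝ) + 1)
            * ((Fintype.card (Fib d) : ℝ) * (CG * (((d + 1 : ℕ) : ℝ) * (CG * Cs * Zl (d + 1) (δ / 2)) + ((d + 1 : ℕ) : ℝ) * (CG * Cm * Zl (d + 1) (δ / 2))))
                * Zl (d + 1) (δ / 2 - δ / 4))
            * (Cs + Cm) * Zl (d + 1) (δ / 4 / 2))) * W) (δ / 8) := by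
  set U : Finset (Site (d + 1)) := T.biUnion (fun y => (box (d + 1) N).image (fun v => (N : ℤ) • y + toSite v)) with hU
  set q : Site (d + 1) := (N : ℤ) • y' with hq
  have hCG : 0 ≤ CG := hG.nonneg (Sum.inl 0)
  have hCs : 0 ≤ Cs := (hS 0 0).nonneg (Sum.inl 0)
  have hCm : 0 ≤ Cm := (hM 0 0).nonneg (Sum.inl 0)
  have hW0 : 0 ≤ W := (faceW_nonneg U (δ / 4) q).trans hW
  -- the three dominations from the one hypothesis
  have hWsite : ∀ μ f, (f ∈ U \ U.image (fun v => v - unitVec μ) ∨ f ∈ U.image (fun v => v - unitVec μ) \ U) →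
      Real.exp (-(δ / 2) * l1 (f - q)) ≤ W := by
    intro μ f hf
    have h1 : Real.exp (-(δ / 2) * l1 (f - q)) ≤ Real.exp (-(δ / 4) * l1 (f - q)) := by
      rw [Real.exp_le_exp]; nlinarith [l1_nonneg (f - q)]
    exact h1.trans ((exp_le_faceW_of_mem U (δ / 4) q hf).trans hW)
  have hW3 := (faceW_mono_rate U (show δ / 4 ≤ δ / 3 by linarith) q).trans hW
  -- (α)
  have hα := biLoc_sum_rotatedVertex_of_faceBound hG hδ hS hM ρ T ν y' hW0 hWsite
  -- (β)
  have hβ := biLoc_sum_vertexOfM_remainder_of_faceW hG hδ hM hM2 hlaw T ν y' hW3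
  -- (γ): the response kernel at rate δ/4, the tables weakened to rate δ/4
  have hA := biLoc_comp_dM hG hδ hS hM ν y'
  have hS4 : LocStencil S Cs (δ / 4) := locStencil_mono hS hCs (by linarith)
  have hM4 : VertexFamily M N Cm (δ / 4) := vertexFamily_mono' hM hCm (by linarith)
  have hγ := biLoc_sum_gaugeSup_faceW_of_faceW hA (by linarith : 0 < δ / 4) hN hS4 hM4 T hW
  have hγ' := biLoc_smul_abs hγ (-((1 / 2 : ℝ) * c))
  -- the split, at the fixed slot
  have hsplit := sum_psi_eq T (Ψ := fun y => Ψ y ν y') (c := c)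
    (Vb := fun y => vertexOfM G N (RM y) ν y')
    (Va := fun y => dM (conjV G (diagK (((1 : ℝ) / 2) • ∑ v ∈ box (d + 1) N, legInd ρ ((N : ℤ) • y + toSite v)))) N S M ν y')
    (Vg := fun y => ∑ κ, wsum (fun u => ∑' x₂, ∑ κ₂,
              comp G (dM G N S M ν y') u x₂ (Sum.inl κ) (Sum.inl κ₂) * gaugeWt N y κ₂ x₂) (S κ)
            + ∑ ρ', cwsum N (fun w => ∑' x₂, ∑ κ₂,
              comp G (dM G N S M ν y') ((N : ℤ) • w) x₂ (Sum.inr ρ') (Sum.inl κ₂) * gaugeWt N y κ₂ x₂) (M ρ'))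
    (fun y _ => hΨ y ν y')
  have hsum_apply : ∑ y ∈ T, Ψ y ν y' = ∑ y ∈ T, (fun y => Ψ y ν y') y := rfl
  rw [hsum_apply, hsplit]
  -- rates to δ/8, then add
  have hα' := biLoc_weaken hα le_rfl (show δ / 8 ≤ δ / 4 by linarith)
  have hβ' := biLoc_weaken hβ le_rfl (show δ / 8 ≤ δ / 6 by linarith)
  have e8 : δ / 4 / 2 = δ / 8 := by ring
  rw [e8] at hγ'
  have habs : |(-((1 / 2 : ℝ) * c))| = (1 / 2 : ℝ) * |c| := by
    rw [abs_neg, abs_mul, abs_of_pos (by norm_num : (0 : ℝ) < 1 / 2)]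
  rw [habs] at hγ'
  have h := biLoc_add (biLoc_add hβ' hα') hγ'
  refine biLoc_weaken h (le_of_eq ?_) le_rfl
  rw [← e8]
  ring

/-- [folklore] **`Ψ_T` IS A FACE LETTER AT THE SLOT, FACE-SUM FORM** (`W := FW_U^{δ∕4}(N•y′)`): rate `δ∕8`, constant `(Kα + Kβ + ½|c|·Kγ)·FW_U^{δ∕4}(N•y′)` — supported near the
boundary layer of the fine union, UNIFORMLY IN `T` except through the face weight. -/
theorem biLoc_sum_psi [NeZero N] {G : MKer (d + 1) (Fib d)} {CG δ : ℝ} (hG : Decays G CG δ) (hδ : 0 < δ) (hN : 1 ≤ N)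
    {S : Fin (d + 1) → Site (d + 1) → MKer (d + 1) (Fib d)} {Cs : ℝ} (hS : LocStencil S Cs δ)
    {M : Fin (d + 1) → Site (d + 1) → MKer (d + 1) (Fib d)} {Cm : ℝ} (hM : VertexFamily M N Cm δ)
    {M2 : Fin (d + 1) → Site (d + 1) → Fin (d + 1) → Site (d + 1) → MKer (d + 1) (Fib d)} {C2 : ℝ} (hM2 : LocStencilFM N M2 C2 δ)
    {RM : Site (d + 1) → Fin (d + 1) → Site (d + 1) → MKer (d + 1) (Fib d)} {cH c : ℝ} {ρ : Site (d + 1)}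
    (hlaw : ∀ (y : Site (d + 1)) (ρ' : Fin (d + 1)) (w : Site (d + 1)),
      cH • ∑ v ∈ box (d + 1) N, divV (fun κ u => M2 κ u ρ' w) ((N : ℤ) • y + toSite v) =
        comp (M ρ' w) (diagK (((1 : ℝ) / 2) • ∑ v ∈ box (d + 1) N, legInd ρ ((N : ℤ) • y + toSite v)))
          - comp (diagK (((1 : ℝ) / 2) • ∑ v ∈ box (d + 1) N, legInd ρ ((N : ℤ) • y + toSite v))) (M ρ' w) + RM y ρ' w)
    {Ψ : Site (d + 1) → Fin (d + 1) → Site (d + 1) → MKer (d + 1) (Fib d)}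
    (hΨ : ∀ (y : Site (d + 1)) (ν : Fin (d + 1)) (y' : Site (d + 1)), Ψ y ν y' =
      vertexOfM G N (RM y) ν y'
      + (1 / 2 : ℝ) • (dM (conjV G (diagK (((1 : ℝ) / 2) • ∑ v ∈ box (d + 1) N, legInd ρ ((N : ℤ) • y + toSite v)))) N S M ν y'
        - c • (∑ κ, wsum (fun u => ∑' x₂, ∑ κ₂,
              comp G (dM G N S M ν y') u x₂ (Sum.inl κ) (Sum.inl κ₂) * gaugeWt N y κ₂ x₂) (S κ)
            + ∑ ρ', cwsum N (fun w => ∑' x₂, ∑ κ₂,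
              comp G (dM G N S M ν y') ((N : ℤ) • w) x₂ (Sum.inr ρ') (Sum.inl κ₂) * gaugeWt N y κ₂ x₂) (M ρ'))))
    (T : Finset (Site (d + 1))) (ν : Fin (d + 1)) (y' : Site (d + 1)) :
    BiLoc (∑ y ∈ T, Ψ y ν y') ((N : ℤ) • y') ((N : ℤ) • y')
      (((1 / 4 : ℝ) * (((d : ℝ) + 1) * CG * Real.exp (δ * l1 ρ) * (Cs + Cm) * Zl (d + 1) (δ / 4))
        + ((d : ℝ) + 1) * CG * (|cH| * C2 + (1 / 2 : ℝ) * Cm * Real.exp (δ * l1 ρ)) * Zl (d + 1) (δ / 6)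
        + (1 / 2 : ℝ) * |c| * (((d : ℝ) + 1)
            * ((Fintype.card (Fib d) : ℝ) * (CG * (((d + 1 : ℕ) : ℝ) * (CG * Cs * Zl (d + 1) (δ / 2)) + ((d + 1 : ℕ) : ℝ) * (CG * Cm * Zl (d + 1) (δ / 2))))
                * Zl (d + 1) (δ / 2 - δ / 4))
            * (Cs + Cm) * Zl (d + 1) (δ / 4 / 2))) * (∑ μ : Fin (d + 1),
          (∑ w' ∈ (T.biUnion (fun y => (box (d + 1) N).image (fun v => (N : ℤ) • y + toSite v))).image (fun v => v - unitVec μ)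
                \ T.biUnion (fun y => (box (d + 1) N).image (fun v => (N : ℤ) • y + toSite v)), Real.exp (-(δ / 4) * l1 (w' - (N : ℤ) • y'))
            + ∑ w' ∈ T.biUnion (fun y => (box (d + 1) N).image (fun v => (N : ℤ) • y + toSite v))
                \ (T.biUnion (fun y => (box (d + 1) N).image (fun v => (N : ℤ) • y + toSite v))).image (fun v => v - unitVec μ),
                  Real.exp (-(δ / 4) * l1 (w' - (N : ℤ) • y'))))) (δ / 8) :=
  biLoc_sum_psi_of_faceW hG hδ hN hS hM hM2 hlaw hΨ T ν y' le_rfl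

end Summit.QuantumFields.BalabanUV.Beta.GAN24.LayerLetterPsi

end
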